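import Mathlib.RingTheory.Nullstellensatz
import Mathlib.Algebra.Order.Antidiag.Finsupp
import Mathlib.RingTheory.Ideal.Quotient.Operations
import Mathlib.RepresentationTheory.Basic
import Literature.Computability.AlgebraicComplexity.LinSubst
import Literature.Computability.AlgebraicComplexity.OrbitClosure
import HarnessLib

-- provenance: harness21/H21/H21/Prelude/CplxAlg/OrbitCoordinateRing.lean @ 7b57685 (interim HEAD d8f2665); M5 mechanical rewrite
/-!
# Coordinate ring of an orbit closure and its `GL`-action

Trunk `CplxAlg` (geometric complexity theory), notion `gct_orbit_closure`, part 3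
(outline C8 / D4). Prepares the (excluded, tier L) notion `gl_sn_irreps_partitions` needed for
**pnp.S28**; no target statement is stated here.

For a form `f` of degree `m` in the variables `σ` over a field `k`, the ambient representation is
`V = Sym^m (k^σ)`, with coordinates the coefficients at the degree-`m` monomials
`degMonomials σ m`. The orbit `GL σ k · f ⊆ V` has vanishing ideal
`orbitVanishingIdeal f m ⊆ k[V] = MvPolynomial (DegIdx σ m) k`, and the *coordinate ring of the
orbit closure* `Δ[f]` is `OrbitCoordRing f m = k[V] ⧸ I(GL · f)`. The group `GL σ k` acts on
`k[V]` by `(g · F)(v) = F(g⁻¹ · v)`, i.e. by the algebra map `coordSubst m g` substituting for each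
coordinate `X_d` the linear form `∑ e, coeff d (g⁻¹ · X^e) • X_e`; this is the representation
`coordRep σ k m`, and `I(GL · f)` is stable under it (`orbitVanishingIdeal_map_coordSubst`), which
is what makes `OrbitCoordRing f m` a `GL σ k`-module (Mulmuley–Sohoni 2001 §4–§5; the
decomposition into irreducibles is left to the L item).

## Sources

* K. Mulmuley, M. Sohoni, *Geometric complexity theory I*, SIAM J. Comput. 31 (2001), §4–§5
  (`Δ[f]`, its coordinate ring `R[Δ[f]]` as a `GL`-module).
* P. Bürgisser, C. Ikenmeyer, G. Panova, *No occurrence obstructions in geometric complexity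
  theory*, J. AMS 32 (2019), §2 (coordinate ring `ℂ[\overline{GL · det_m}]`).
* P. Bürgisser, J. M. Landsberg, L. Manivel, J. Weyman, *An overview of mathematical issues
  arising in the geometric complexity theory approach to VP ≠ VNP*, SIAM J. Comput. 40 (2011), §2.

## Mathlib

Mathlib has `Finset.finsuppAntidiag` (monomials of given degree with support in a finset),
`MvPolynomial.vanishingIdeal`, `MvPolynomial.zeroLocus`, `Ideal.map`, ideal quotients with their
`CommRing`/`Algebra` instances, `Representation`, `AlgHom.toEnd`; all are used. It has no
coordinate ring of an orbit closure nor the induced `GL`-action on polynomial functions on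
`Sym^m`, which this file supplies.

## Design

* Coordinates are indexed by the *finite* type `DegIdx σ m = ↥(degMonomials σ m)` (a `Finset`
  coerced to a type, hence a `Fintype`), so that `k[V]` is a polynomial ring in finitely many
  variables and sums over coordinates are `Finset` sums.
* `coordSubst m g` is `aeval` of explicit linear forms (`F ↦ F ∘ ρ(g⁻¹)`); `coordSubst_one` and
  `coordSubst_mul` are proved sorry-free (they feed the definition `coordRep`), via the expansion
  `coeff_linSubstRep_eq_sum` of `coeff d (A · p)` for a degree-`m` form `p`.
* `coordRep σ k m` is the composite of monoid homs `AlgHom.toEnd ∘ coordSubstMonoidHom`, so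
  `coordRep_apply` is `rfl` (same pattern as `linSubstRep`, outline C6).
* `aeval_formCoeff_coordSubst` (equivariance) and `orbitVanishingIdeal_map_coordSubst`
  (`GL`-stability of `I(GL · f)`) are proved sorry-free, so the induced representation
  `orbitCoordRep f m` on the quotient `OrbitCoordRing f m` is defined (via `Ideal.quotientMapₐ`),
  again as a composite of monoid homs. Only the bridge `mem_orbitClosure_iff_formCoeff` is left
  `sorry`.
-/

noncomputable section

open MvPolynomial

namespace Literature.Computability.AlgebraicComplexity

/-! ### Degree-`m` monomials and coefficients of forms -/

section Coords

variable (σ : Type*) {k : Type*} [Fintype σ] [DecidableEq σ] [CommRing k]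

/-- The finset of monomials (exponent vectors) `d : σ →₀ ℕ` of total degree `m`, i.e. the
monomial basis of `Sym^m (k^σ)`; this is Mathlib's `Finset.univ.finsuppAntidiag m`.
Mulmuley–Sohoni 2001 §4 (`V = Sym^m`). [cite: MulmuleySohoni2001, §4 ( V = Sym^m] -/
def degMonomials (m : ℕ) : Finset (σ →₀ ℕ) :=
  Finset.univ.finsuppAntidiag m

/-- The finite index type of coordinates on `Sym^m (k^σ)`: monomials of degree `m`.
Mulmuley–Sohoni 2001 §4. [cite: MulmuleySohoni2001, §4] -/
abbrev DegIdx (m : ℕ) : Type _ :=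
  ↥(degMonomials σ m)

variable {σ}

/-- A monomial lies in `degMonomials σ m` iff its degree is `m`. Mulmuley–Sohoni 2001 §4. [cite: MulmuleySohoni2001, §4] -/
@[simp]
theorem mem_degMonomials_iff {m : ℕ} {d : σ →₀ ℕ} : d ∈ degMonomials σ m ↔ d.degree = m := by
  simp [degMonomials, Finset.mem_finsuppAntidiag, Finsupp.degree_eq_sum]

/-- The degree-`m` coefficient vector of a polynomial: the point `d ↦ coeff d f` of the affine
space `Sym^m (k^σ) = (DegIdx σ m → k)`. For `f` a form of degree `m` this is `f` itself as a
point of `V = Sym^m`. Mulmuley–Sohoni 2001 §4. [cite: MulmuleySohoni2001, §4] -/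
def formCoeff (m : ℕ) (f : MvPolynomial σ k) : DegIdx σ m → k :=
  fun d => coeff d.1 f

/-- Unfolding lemma for `formCoeff` (Mulmuley–Sohoni 2001 §4). [cite: MulmuleySohoni2001, §4] -/
@[simp]
theorem formCoeff_apply (m : ℕ) (f : MvPolynomial σ k) (d : DegIdx σ m) :
    formCoeff m f d = coeff d.1 f :=
  rfl

/-- `formCoeff m` is `k`-linear: additive. Mulmuley–Sohoni 2001 §4. [cite: MulmuleySohoni2001, §4] -/
@[simp]
theorem formCoeff_add (m : ℕ) (f g : MvPolynomial σ k) :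
    formCoeff m (f + g) = formCoeff m f + formCoeff m g := by
  ext d; simp

/-- `formCoeff m` is `k`-linear: homogeneous. Mulmuley–Sohoni 2001 §4. [cite: MulmuleySohoni2001, §4] -/
@[simp]
theorem formCoeff_smul (m : ℕ) (c : k) (f : MvPolynomial σ k) :
    formCoeff m (c • f) = c • formCoeff m f := by
  ext d; simp

/-- A form of degree `m` is determined by its degree-`m` coefficients: `formCoeff m` is injective
on `homogeneousSubmodule σ k m`. Mulmuley–Sohoni 2001 §4. [cite: MulmuleySohoni2001, §4] -/
theorem formCoeff_injOn_homogeneousSubmodule (m : ℕ) :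
    Set.InjOn (formCoeff (k := k) m) (homogeneousSubmodule σ k m : Set (MvPolynomial σ k)) := by
  intro f hf g hg h
  ext d
  by_cases hd : d.degree = m
  · exact congr_fun h ⟨d, mem_degMonomials_iff.mpr hd⟩
  · rw [((mem_homogeneousSubmodule m f).mp hf).coeff_eq_zero hd,
      ((mem_homogeneousSubmodule m g).mp hg).coeff_eq_zero hd]

/-- A form of degree `m` is the sum of its degree-`m` monomials, indexed by the finite type
`DegIdx σ m`. Mulmuley–Sohoni 2001 §4. [cite: MulmuleySohoni2001, §4] -/
theorem sum_coeff_smul_monomial_eq {m : ℕ} {p : MvPolynomial σ k}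
    (hp : p.IsHomogeneous m) :
    ∑ e : DegIdx σ m, coeff e.1 p • (monomial e.1 (1 : k)) = p := by
  have hsub : p.support ⊆ degMonomials σ m := fun e he =>
    mem_degMonomials_iff.mpr (by
      rw [Finsupp.degree_eq_weight_one]
      exact hp (mem_support_iff.mp he))
  rw [Finset.sum_coe_sort (degMonomials σ m) fun e => coeff e p • (monomial e (1 : k))]
  rw [← Finset.sum_subset hsub fun e _ he => by simp [notMem_support_iff.mp he]]
  conv_rhs => rw [← support_sum_monomial_coeff p]
  refine Finset.sum_congr rfl fun e _ => ?_
  rw [smul_monomial, smul_eq_mul, mul_one]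

/-- Expansion of the action on a form in the monomial basis of `Sym^m`: for `p` homogeneous of
degree `m` and `d` of degree `m`,
`coeff d (g · p) = ∑ e, coeff e p * coeff d (g · X^e)`. Mulmuley–Sohoni 2001 §4. [cite: MulmuleySohoni2001, §4] -/
theorem coeff_linSubstRep_eq_sum {m : ℕ} (g : GL σ k) {p : MvPolynomial σ k}
    (hp : p.IsHomogeneous m) (d : DegIdx σ m) :
    coeff d.1 (linSubstRep σ k g p) =
      ∑ e : DegIdx σ m, coeff e.1 p * coeff d.1 (linSubstRep σ k g (monomial e.1 1)) := by
  conv_lhs => rw [← sum_coeff_smul_monomial_eq hp]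
  simp only [map_sum, map_smul, coeff_sum, coeff_smul, smul_eq_mul]

end Coords

/-! ### The action of `GL σ k` on the coordinate ring of `Sym^m` -/

section Subst

variable {σ k : Type*} [Fintype σ] [DecidableEq σ] [CommRing k]

/-- The degree-`n` coefficients of `g · q` only depend on the degree-`n` component of `q`
(the action preserves the grading). Landsberg 2017 §1.2. [cite: Landsberg2017, §1.2] -/
theorem coeff_linSubstRep_eq_coeff_homogeneousComponent (g : GL σ k) (q : MvPolynomial σ k)
    (d : σ →₀ ℕ) :
    coeff d (linSubstRep σ k g q) = coeff d (linSubstRep σ k g (homogeneousComponent d.degree q)) := by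
  induction q using MvPolynomial.induction_on' with
  | monomial u a =>
    rw [homogeneousComponent_of_mem (isHomogeneous_monomial a rfl)]
    split_ifs with hu
    · rfl
    · rw [map_zero, coeff_zero]
      exact (linSubst_isHomogeneous (g : Matrix σ σ k) (isHomogeneous_monomial a rfl)).coeff_eq_zero
        hu
  | add p q hp hq => simp only [map_add, coeff_add, hp, hq]

/-- The action of `g : GL σ k` on polynomial functions `F` on `V = Sym^m (k^σ)`,
`(g · F)(v) = F(g⁻¹ · v)`: the `k`-algebra endomorphism of `k[V] = MvPolynomial (DegIdx σ m) k`
substituting for the coordinate `X_d` the linear form `∑ e, coeff d (g⁻¹ · X^e) • X_e`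
(the `d`-th coordinate of `g⁻¹ · v`). Mulmuley–Sohoni 2001 §4–§5;
Bürgisser–Ikenmeyer–Panova 2019 §2. [cite: MulmuleySohoni2001, §4–§5] -/
def coordSubst (m : ℕ) (g : GL σ k) :
    MvPolynomial (DegIdx σ m) k →ₐ[k] MvPolynomial (DegIdx σ m) k :=
  aeval fun d => ∑ e : DegIdx σ m, coeff d.1 (linSubstRep σ k g⁻¹ (monomial e.1 1)) • X e

/-- `coordSubst` on a coordinate function. Mulmuley–Sohoni 2001 §4. [cite: MulmuleySohoni2001, §4] -/
@[simp]
theorem coordSubst_X (m : ℕ) (g : GL σ k) (d : DegIdx σ m) :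
    coordSubst m g (X d) =
      ∑ e : DegIdx σ m, coeff d.1 (linSubstRep σ k g⁻¹ (monomial e.1 1)) • X e := by
  simp [coordSubst]

variable (σ k)

/-- The identity acts as the identity on `k[Sym^m]`. Mulmuley–Sohoni 2001 §4. [cite: MulmuleySohoni2001, §4] -/
theorem coordSubst_one (m : ℕ) : coordSubst m (1 : GL σ k) = AlgHom.id k _ := by
  apply MvPolynomial.algHom_ext
  intro d
  simp only [coordSubst_X, inv_one, map_one, Module.End.one_apply, coeff_monomial,
    AlgHom.coe_id, id_eq, ite_smul, one_smul, zero_smul]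
  rw [Finset.sum_eq_single d (fun e _ hne => if_neg fun h => hne (Subtype.ext h))
    (fun h => absurd (Finset.mem_univ d) h), if_pos rfl]

/-- `coordSubst` is multiplicative: `(g * h) · F = g · (h · F)`. Mulmuley–Sohoni 2001 §4. [cite: MulmuleySohoni2001, §4] -/
theorem coordSubst_mul (m : ℕ) (g h : GL σ k) :
    coordSubst m (g * h) = (coordSubst m g).comp (coordSubst m h) := by
  apply MvPolynomial.algHom_ext
  intro d
  simp only [AlgHom.comp_apply, coordSubst_X, map_sum, map_smul, mul_inv_rev, map_mul,
    Module.End.mul_apply]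
  have H : ∀ c : DegIdx σ m,
      coeff d.1 (linSubstRep σ k h⁻¹ (linSubstRep σ k g⁻¹ (monomial c.1 1))) =
        ∑ e : DegIdx σ m, coeff e.1 (linSubstRep σ k g⁻¹ (monomial c.1 1)) *
          coeff d.1 (linSubstRep σ k h⁻¹ (monomial e.1 1)) := fun c =>
    coeff_linSubstRep_eq_sum h⁻¹ (linSubst_isHomogeneous _
      (isHomogeneous_monomial _ (mem_degMonomials_iff.mp c.2))) d
  simp only [H, Finset.sum_smul, Finset.smul_sum, smul_smul]
  rw [Finset.sum_comm]
  simp only [mul_comm]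

/-- `coordSubst` as a monoid homomorphism `GL σ k →* (k[Sym^m] →ₐ[k] k[Sym^m])`.
Mulmuley–Sohoni 2001 §4. [cite: MulmuleySohoni2001, §4] -/
def coordSubstMonoidHom (m : ℕ) :
    GL σ k →* (MvPolynomial (DegIdx σ m) k →ₐ[k] MvPolynomial (DegIdx σ m) k) where
  toFun := coordSubst m
  map_one' := coordSubst_one σ k m
  map_mul' := coordSubst_mul σ k m

/-- `coordSubstMonoidHom` is `coordSubst` (unfolding lemma; Mulmuley–Sohoni 2001 §4). [cite: MulmuleySohoni2001, §4] -/
@[simp]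
theorem coordSubstMonoidHom_apply (m : ℕ) (g : GL σ k) :
    coordSubstMonoidHom σ k m g = coordSubst m g :=
  rfl

/-- The representation of `GL σ k` on the coordinate ring `k[Sym^m (k^σ)]`,
`(g · F)(v) = F(g⁻¹ · v)`, defined as the composite `AlgHom.toEnd ∘ coordSubstMonoidHom`.
Mulmuley–Sohoni 2001 §4–§5; Bürgisser–Ikenmeyer–Panova 2019 §2. [cite: MulmuleySohoni2001, §4–§5] -/
def coordRep (m : ℕ) : Representation k (GL σ k) (MvPolynomial (DegIdx σ m) k) :=
  AlgHom.toEnd.comp (coordSubstMonoidHom σ k m)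

/-- `coordRep σ k m g F = coordSubst m g F`, by `rfl` (unfolding lemma; Mulmuley–Sohoni 2001 §4). [cite: MulmuleySohoni2001, §4] -/
@[simp]
theorem coordRep_apply (m : ℕ) (g : GL σ k) (F : MvPolynomial (DegIdx σ m) k) :
    coordRep σ k m g F = coordSubst m g F :=
  rfl

variable {σ k}

/-- Equivariance of evaluation: `(g · F)(h) = F(g⁻¹ · h)` on degree-`m` coefficient vectors,
`aeval (formCoeff m h) (coordSubst m g F) = aeval (formCoeff m (g⁻¹ · h)) F`.
Mulmuley–Sohoni 2001 §4. [cite: MulmuleySohoni2001, §4] -/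
theorem aeval_formCoeff_coordSubst (m : ℕ) (g : GL σ k) (h : MvPolynomial σ k)
    (F : MvPolynomial (DegIdx σ m) k) :
    aeval (formCoeff m h) (coordSubst m g F) = aeval (formCoeff m (linSubstRep σ k g⁻¹ h)) F := by
  suffices H : (aeval (formCoeff m h)).comp (coordSubst m g) =
      aeval (formCoeff m (linSubstRep σ k g⁻¹ h)) from
    congrArg (fun φ => φ F) H
  apply MvPolynomial.algHom_ext
  intro d
  simp only [AlgHom.comp_apply, coordSubst_X, map_sum, map_smul, aeval_X, formCoeff_apply,
    smul_eq_mul]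
  rw [coeff_linSubstRep_eq_coeff_homogeneousComponent, mem_degMonomials_iff.mp d.2,
    coeff_linSubstRep_eq_sum g⁻¹ (homogeneousComponent_isHomogeneous m h) d]
  refine Finset.sum_congr rfl fun e _ => ?_
  rw [coeff_homogeneousComponent, if_pos (mem_degMonomials_iff.mp e.2), mul_comm]

end Subst

/-! ### The vanishing ideal of the orbit and the coordinate ring of `Δ[f]` -/

section CoordRing

variable {σ k : Type*} [Fintype σ] [DecidableEq σ] [Field k]

/-- The vanishing ideal `I(GL · f) ⊆ k[Sym^m]` of the orbit of `f`: polynomials in the degree-`m`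
coefficients vanishing on `formCoeff m '' glOrbit σ k f`. Its zero locus is the orbit closure
`Δ[f]` (`mem_orbitClosure_iff_formCoeff`). Mulmuley–Sohoni 2001 §4. [cite: MulmuleySohoni2001, §4] -/
def orbitVanishingIdeal (f : MvPolynomial σ k) (m : ℕ) : Ideal (MvPolynomial (DegIdx σ m) k) :=
  MvPolynomial.vanishingIdeal k (formCoeff m '' glOrbit σ k f)

/-- Membership in `orbitVanishingIdeal`: `F` vanishes at every point of the orbit.
Mulmuley–Sohoni 2001 §4. [cite: MulmuleySohoni2001, §4] -/
theorem mem_orbitVanishingIdeal_iff {f : MvPolynomial σ k} {m : ℕ}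
    {F : MvPolynomial (DegIdx σ m) k} :
    F ∈ orbitVanishingIdeal f m ↔ ∀ g : GL σ k, aeval (formCoeff m (linSubstRep σ k g f)) F = 0 := by
  simp only [orbitVanishingIdeal, MvPolynomial.mem_vanishingIdeal_iff, glOrbit,
    Set.forall_mem_image, Set.forall_mem_range]

/-- The coordinate ring `k[Δ[f]] = k[Sym^m] ⧸ I(GL · f)` of the orbit closure of `f` (in degree
`m`; meaningful for `f` a form of degree `m`). It inherits `CommRing` and `Algebra k` instances
from the quotient. Mulmuley–Sohoni 2001 §5; Bürgisser–Ikenmeyer–Panova 2019 §2. [cite: MulmuleySohoni2001, §5] -/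
abbrev OrbitCoordRing (f : MvPolynomial σ k) (m : ℕ) : Type _ :=
  MvPolynomial (DegIdx σ m) k ⧸ orbitVanishingIdeal f m

/-- Bridge to `orbitClosure` (file `OrbitClosure.lean`): for a nonzero form `f` of degree `m`,
`g ∈ Δ[f]` iff `g` is a form of degree `m` whose degree-`m` coefficient vector lies in the zero
locus of `I(GL · f)`. Mulmuley–Sohoni 2001 §4 (outline D4/C8). [cite: MulmuleySohoni2001, §4 (outline D4/C8] -/
def mem_orbitClosure_iff_formCoeff : Prop :=
  ∀ {f g : MvPolynomial σ k} {m : ℕ} (hf : f.IsHomogeneous m) (hf0 : f ≠ 0),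
    g ∈ orbitClosure f ↔ g ∈ homogeneousSubmodule σ k m ∧
      formCoeff m g ∈ MvPolynomial.zeroLocus k (orbitVanishingIdeal f m)

/-- `GL`-stability of the vanishing ideal of the orbit: `g · I(GL · f) = I(GL · f)` for every
`g : GL σ k`, so that `coordRep` descends to the coordinate ring `OrbitCoordRing f m`
(the `GL`-module `R[Δ[f]]` of Mulmuley–Sohoni 2001 §5, enabling **pnp.S28** later). [cite: MulmuleySohoni2001, §5  enabling  later] -/
theorem orbitVanishingIdeal_map_coordSubst (f : MvPolynomial σ k) (m : ℕ) (g : GL σ k) :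
    Ideal.map (coordSubst m g) (orbitVanishingIdeal f m) = orbitVanishingIdeal f m := by
  have hle : ∀ g : GL σ k,
      Ideal.map (coordSubst m g) (orbitVanishingIdeal f m) ≤ orbitVanishingIdeal f m := by
    intro g
    rw [Ideal.map_le_iff_le_comap]
    intro F hF
    rw [Ideal.mem_comap, mem_orbitVanishingIdeal_iff]
    intro h
    rw [aeval_formCoeff_coordSubst, ← Module.End.mul_apply, ← map_mul]
    exact mem_orbitVanishingIdeal_iff.mp hF _
  refine le_antisymm (hle g) fun F hF => ?_
  have hF' : coordSubst m g (coordSubst m g⁻¹ F) = F := by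
    rw [← AlgHom.comp_apply, ← coordSubst_mul, mul_inv_cancel, coordSubst_one, AlgHom.id_apply]
  rw [← hF']
  exact Ideal.mem_map_of_mem _ (hle g⁻¹ (Ideal.mem_map_of_mem _ hF))

/-- The vanishing ideal of the orbit is contained in its preimage under `coordSubst m g`
(the hypothesis of `Ideal.quotientMapₐ`). Mulmuley–Sohoni 2001 §5. [cite: MulmuleySohoni2001, §5] -/
theorem orbitVanishingIdeal_le_comap_coordSubst (f : MvPolynomial σ k) (m : ℕ) (g : GL σ k) :
    orbitVanishingIdeal f m ≤ (orbitVanishingIdeal f m).comap (coordSubst m g) := by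
  rw [← Ideal.map_le_iff_le_comap, orbitVanishingIdeal_map_coordSubst]

/-- The action of `g : GL σ k` on the coordinate ring `k[Δ[f]] = k[Sym^m] ⧸ I(GL · f)`, induced
by `coordSubst m g` on the quotient. Mulmuley–Sohoni 2001 §5; Bürgisser–Ikenmeyer–Panova 2019
§2. [cite: MulmuleySohoni2001, §5] -/
def orbitCoordSubst (f : MvPolynomial σ k) (m : ℕ) (g : GL σ k) :
    OrbitCoordRing f m →ₐ[k] OrbitCoordRing f m :=
  Ideal.quotientMapₐ (orbitVanishingIdeal f m) (coordSubst m g)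
    (orbitVanishingIdeal_le_comap_coordSubst f m g)

/-- `orbitCoordSubst` on the class of a polynomial function. Mulmuley–Sohoni 2001 §5. [cite: MulmuleySohoni2001, §5] -/
@[simp]
theorem orbitCoordSubst_mk (f : MvPolynomial σ k) (m : ℕ) (g : GL σ k)
    (F : MvPolynomial (DegIdx σ m) k) :
    orbitCoordSubst f m g (Ideal.Quotient.mk (orbitVanishingIdeal f m) F) =
      Ideal.Quotient.mk (orbitVanishingIdeal f m) (coordSubst m g F) :=
  rfl

/-- The identity acts as the identity on `k[Δ[f]]`. Mulmuley–Sohoni 2001 §5. [cite: MulmuleySohoni2001, §5] -/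
theorem orbitCoordSubst_one (f : MvPolynomial σ k) (m : ℕ) :
    orbitCoordSubst f m (1 : GL σ k) = AlgHom.id k _ := by
  apply Ideal.Quotient.algHom_ext
  ext F : 1
  simp only [AlgHom.comp_apply, Ideal.Quotient.mkₐ_eq_mk, orbitCoordSubst_mk, coordSubst_one,
    AlgHom.id_apply]

/-- `orbitCoordSubst` is multiplicative. Mulmuley–Sohoni 2001 §5. [cite: MulmuleySohoni2001, §5] -/
theorem orbitCoordSubst_mul (f : MvPolynomial σ k) (m : ℕ) (g h : GL σ k) :
    orbitCoordSubst f m (g * h) = (orbitCoordSubst f m g).comp (orbitCoordSubst f m h) := by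
  apply Ideal.Quotient.algHom_ext
  ext F : 1
  simp only [AlgHom.comp_apply, Ideal.Quotient.mkₐ_eq_mk, orbitCoordSubst_mk, coordSubst_mul]

/-- `orbitCoordSubst` as a monoid homomorphism `GL σ k →* (k[Δ[f]] →ₐ[k] k[Δ[f]])`.
Mulmuley–Sohoni 2001 §5. [cite: MulmuleySohoni2001, §5] -/
def orbitCoordSubstMonoidHom (f : MvPolynomial σ k) (m : ℕ) :
    GL σ k →* (OrbitCoordRing f m →ₐ[k] OrbitCoordRing f m) where
  toFun := orbitCoordSubst f m
  map_one' := orbitCoordSubst_one f m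
  map_mul' := orbitCoordSubst_mul f m

/-- `orbitCoordSubstMonoidHom` is `orbitCoordSubst` (unfolding lemma; Mulmuley–Sohoni 2001 §5). [cite: MulmuleySohoni2001, §5] -/
@[simp]
theorem orbitCoordSubstMonoidHom_apply (f : MvPolynomial σ k) (m : ℕ) (g : GL σ k) :
    orbitCoordSubstMonoidHom f m g = orbitCoordSubst f m g :=
  rfl

/-- The `GL σ k`-module structure on the coordinate ring `R[Δ[f]] = k[Sym^m] ⧸ I(GL · f)` of the
orbit closure of `f`, as a Mathlib `Representation`; its decomposition into irreducibles carries
the representation-theoretic obstructions of GCT. Mulmuley–Sohoni 2001 §5;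
Bürgisser–Ikenmeyer–Panova 2019 §2. [cite: MulmuleySohoni2001, §5] -/
def orbitCoordRep (f : MvPolynomial σ k) (m : ℕ) : Representation k (GL σ k) (OrbitCoordRing f m) :=
  AlgHom.toEnd.comp (orbitCoordSubstMonoidHom f m)

/-- `orbitCoordRep f m g x = orbitCoordSubst f m g x`, by `rfl` (unfolding lemma;
Mulmuley–Sohoni 2001 §5). [cite: MulmuleySohoni2001, §5] -/
@[simp]
theorem orbitCoordRep_apply (f : MvPolynomial σ k) (m : ℕ) (g : GL σ k) (x : OrbitCoordRing f m) :
    orbitCoordRep f m g x = orbitCoordSubst f m g x :=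
  rfl

end CoordRing

end Literature.Computability.AlgebraicComplexity
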